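import Mathlib
import HarnessLib
import Literature.Computability.AlgebraicComplexity.CircuitDepthProductDepthOne
import Summits.ValiantsHypothesis.ValiantsHypothesis.Theorems.SuccinctLiftFiniteFields
import Summits.ValiantsHypothesis.ValiantsHypothesis.Theorems.DefinabilityGapK1DepthLadder

/-!
# SuccinctLift — the `§4` constant dial and the walls `K_alg`, `H`, `D` in ROBUST form
# (F4 rule of the decomp-valiant workshop, census 724 / critic 726; support for the WALL-D item
# `stmt-ValiantsHypothesis-23721` `AlgDescentLog3` of route `SuccinctLift`, lens 2)

The census instrument DIALFORM-AUDIT-v1 (bus 724, F3) and the critic (bus 726) recorded that the `§4 (w6)`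
statements of `SuccinctLiftFiniteFields` — `not_perEasy{Complex,Alg,IntAdv,PolyAdv,CF}_belowHalf` and
`walls_belowHalf`, all at the VANISHING budget `fun n ↦ p · L₃ n / q` (`L₃ = ⌊log₂⌊log₂⌊log₂ ·⌋⌋⌋`) — are decided at
`n = 2` (`SuccinctLiftWallsDialAtTwo.walls_all_slopes`: they hold at EVERY slope, slope `100` included), hence are
«TRUE BY DEGENERATE WITNESS · NOT EVIDENCE», and adopted the rule F4: rungs / walls on `L₃` dials only in ROBUST
form — budget `⌊p · L₃ n / q⌋ + K` for every shift `K`, hardness in the shape `∀ K c m₀, ∃ n ≥ m₀, …`.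

This file is lens 2's execution of F4 on its own `§4`.  At every ROBUST budget
`Δ = fun n ↦ p · L₃ n / q + K` of slope `p / q ≤ 18/25` (every `K : ℕ`):

* §1 the whole constant dial is HARD — `¬ PerEasyComplex Δ`, `¬ PerEasyAlg Δ`, `¬ PerEasyIntAdv Δ`,
  `¬ PerEasyPolyAdv Δ`, `¬ PerEasyCF Δ` — as one-line corollaries of the ROBUST per-rung
  `DefinabilityGapK1DepthLadder.perHard_io_log3` (`25 p ≤ 18 q`; Limaye–Srinivasan–Tavenas for `IMM` at a tower,
  transported to `per` by VNP-completeness, Bhargav–Dutta–Saxena homogenisation), NOT of the `n = 2` witness;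
* §2 hence the three walls `AlgConstantLiftAt Δ` (`K_alg`), `HeightLiftAt Δ` (`H`), `AlgDescentAt Δ` (`D`) HOLD at
  every robust budget of slope `≤ 18/25` — by TRUE CONSEQUENT (`¬ PerEasyAlg Δ`, `¬ PerEasyIntAdv Δ`); in particular
  at every CONSTANT budget `K` (slope `0`);
* §3 NON-DEGENERACY certificate: for `1 ≤ K` no single `n` decides these statements — every `per_n` HAS a circuit
  of product-depth `1 ≤ Δ n` over `ℂ` (the `ΣΠ` circuit along its support,
  `ArithCircuit.exists_computes_productDepth_one_holds`), so the negated dial points of §1 are genuine SIZE lower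
  bounds (`∀ c ∃ n`, wires `> n^c + c`), unlike the vanishing-budget statements, where `per_2` has NO circuit at all.

Honest reading for the record (replacing the downgraded sentence «the walls K_alg, H, D hold ∀κ < 1/2 (kernel)»):
«the walls `K_alg`, `H`, `D` hold at every ROBUST budget `⌊p · L₃ n / q⌋ + K` of slope `p/q ≤ 18/25` (kernel;
DECIDED-BY-RUNG: true consequent via `perHard_io_log3`; non-degenerate) — this is NOT evidence about the wall
MECHANISMS (constant lifting / height / algebraic descent), which carry content only where per-hardness over `ℂ`
is open: in robust form, slopes in `(18/25, 1]`, containing the route budget `L₃ n + 1` of the items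
`HeightLiftLog3` / `AlgDescentLog3` / `AlgConstantLiftLog3` (unchanged, not re-tagged here)».  Hygiene / support
only: no new items, no tag changes, `VP ≠ VNP` untouched (LADDER-Valiant rung 0).

References: [LimayeSrinivasanTavenas2025, Cor. 4, Lemma 11] and [BhargavDuttaSaxena2024, Thm. 1.4] (the robust
per-rung this file consumes, via `perHard_io_log3`); [Burgisser2000, §4.1, Thm. 4.13] (the constants dial
`D0 ⊆ D1 ⊆ D2 ⊆ Dtop` and the walls); [KoiranPerifel2011, §2] (integer advice); [LST2021, §1] (`ΣΠ` circuits have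
product-depth `1`).
-/

set_option linter.dupNamespace false

namespace Summit.ValiantsHypothesis.ValiantsHypothesis.Theorems.SuccinctLiftWallsRobust

open Literature.Computability.AlgebraicComplexity
open Summit.ValiantsHypothesis.ValiantsHypothesis.Theorems

/-! ### §1 The constant dial at a robust budget of slope `≤ 18/25` is hard (corollaries of `perHard_io_log3`) -/

/-- **Dℂ is hard at every robust budget of slope `≤ 18/25`**: no `∃ c ∀ n` family of `n^c + c`-wire circuits over
`ℂ` of product-depth `≤ ⌊p · L₃ n / q⌋ + K` computes the permanent — the robust per-rung `perHard_io_log3`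
supplies, for every `c`, an `n` at which every such circuit has MORE than `n^c + c` wires.
[cite: LimayeSrinivasanTavenas2025, Cor. 4] [cite: BhargavDuttaSaxena2024, Thm. 1.4] -/
theorem not_perEasyComplex_robust {p q : ℕ} (hpq : 25 * p ≤ 18 * q) (K : ℕ) :
    ¬ SuccinctLift.PerEasyComplex fun n => p * Nat.log 2 (Nat.log 2 (Nat.log 2 n)) / q + K := by
  intro h
  obtain ⟨c, hc⟩ := h
  obtain ⟨n, -, hn⟩ := DefinabilityGapK1DepthLadder.perHard_io_log3 hpq K c 0
  obtain ⟨C, hC, hd, hs⟩ := hc n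
  exact absurd hs (not_le.mpr (hn C hC hd))

/-- … hence **Dtop is hard**: no such family with constants in `algebraicClosure ℚ ℂ`
(`perEasyComplex_iff_perEasyAlg`). [cite: Burgisser2000, §4.1] -/
theorem not_perEasyAlg_robust {p q : ℕ} (hpq : 25 * p ≤ 18 * q) (K : ℕ) :
    ¬ SuccinctLift.PerEasyAlg fun n => p * Nat.log 2 (Nat.log 2 (Nat.log 2 n)) / q + K :=
  fun h => not_perEasyComplex_robust hpq K ((SuccinctLift.perEasyComplex_iff_perEasyAlg _).mpr h)

/-- … hence **D2 is hard**: integer advice of any height does not help. [cite: KoiranPerifel2011, §2] -/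
theorem not_perEasyIntAdv_robust {p q : ℕ} (hpq : 25 * p ≤ 18 * q) (K : ℕ) :
    ¬ SuccinctLift.PerEasyIntAdv fun n => p * Nat.log 2 (Nat.log 2 (Nat.log 2 n)) / q + K :=
  fun h => not_perEasyComplex_robust hpq K (SuccinctLift.perEasyComplex_of_perEasyIntAdv _ h)

/-- … hence **D1 is hard**: polynomial-height integer advice does not help. [cite: KoiranPerifel2011, §2] -/
theorem not_perEasyPolyAdv_robust {p q : ℕ} (hpq : 25 * p ≤ 18 * q) (K : ℕ) :
    ¬ SuccinctLift.PerEasyPolyAdv fun n => p * Nat.log 2 (Nat.log 2 (Nat.log 2 n)) / q + K :=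
  fun h => not_perEasyIntAdv_robust hpq K (SuccinctLift.perEasyIntAdv_of_perEasyPolyAdv _ h)

/-- … hence **D0 is hard**: constant-free (sign-constant) circuits. [cite: KoiranPerifel2011, §2] -/
theorem not_perEasyCF_robust {p q : ℕ} (hpq : 25 * p ≤ 18 * q) (K : ℕ) :
    ¬ SuccinctLift.PerEasyCF fun n => p * Nat.log 2 (Nat.log 2 (Nat.log 2 n)) / q + K :=
  fun h => not_perEasyPolyAdv_robust hpq K (SuccinctLift.perEasyPolyAdv_of_perEasyCF _ h)

/-! ### §2 The walls in robust form -/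

/-- **F4 form of `walls_belowHalf`**: the three walls `K_alg = AlgConstantLiftAt Δ`, `H = HeightLiftAt Δ`,
`D = AlgDescentAt Δ` HOLD at every ROBUST budget `Δ = ⌊p · L₃ n / q⌋ + K` of slope `p / q ≤ 18/25`, for every
shift `K` — by true consequent (§1), i.e. DECIDED-BY-RUNG, not by the `n = 2` witness.
[cite: Burgisser2000, §4.1, Thm. 4.13] [cite: LimayeSrinivasanTavenas2025, Cor. 4] -/
theorem walls_robust {p q : ℕ} (hpq : 25 * p ≤ 18 * q) (K : ℕ) :
    SuccinctLift.AlgConstantLiftAt (fun n => p * Nat.log 2 (Nat.log 2 (Nat.log 2 n)) / q + K) ∧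
      SuccinctLift.HeightLiftAt (fun n => p * Nat.log 2 (Nat.log 2 (Nat.log 2 n)) / q + K) ∧
      SuccinctLift.AlgDescentAt (fun n => p * Nat.log 2 (Nat.log 2 (Nat.log 2 n)) / q + K) :=
  ⟨fun _ => not_perEasyAlg_robust hpq K,
    SuccinctLift.heightLiftAt_of_perHardAlg _ (not_perEasyAlg_robust hpq K),
    SuccinctLift.algDescentAt_of_perHardAlg _ (not_perEasyAlg_robust hpq K)⟩

/-- The below-one-half slopes of the landed `walls_belowHalf` (`2 p < q`) are inside the robust range
(`2 p < q → 25 p ≤ 18 q`), so **every statement of `§4` holds in robust form with an arbitrary shift `K`**.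
[cite: LimayeSrinivasanTavenas2025, Cor. 4] -/
theorem walls_belowHalf_robust (p q : ℕ) (hpq : 2 * p < q) (K : ℕ) :
    SuccinctLift.AlgConstantLiftAt (fun n => p * Nat.log 2 (Nat.log 2 (Nat.log 2 n)) / q + K) ∧
      SuccinctLift.HeightLiftAt (fun n => p * Nat.log 2 (Nat.log 2 (Nat.log 2 n)) / q + K) ∧
      SuccinctLift.AlgDescentAt (fun n => p * Nat.log 2 (Nat.log 2 (Nat.log 2 n)) / q + K) :=
  walls_robust (by omega) K

/-- **Slope `0`: the walls hold at every CONSTANT product-depth budget `K`** (the constant-depth regime of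
`DepthWindowConstDepth.perHardConstDepth`, here read off `perHard_io_log3` with `p = 0`).
[cite: LimayeSrinivasanTavenas2025, Cor. 4] -/
theorem walls_constDepth (K : ℕ) :
    SuccinctLift.AlgConstantLiftAt (fun _ => K) ∧ SuccinctLift.HeightLiftAt (fun _ => K) ∧
      SuccinctLift.AlgDescentAt (fun _ => K) := by
  have h := walls_robust (p := 0) (q := 1) (Nat.zero_le _) K
  simpa using h

/-- The constant-free dial point at constant depth, for the record: **no `∃ c ∀ n` family of constant-free
`n^c + c`-wire circuits of ANY constant product-depth `K` computes per**. [cite: KoiranPerifel2011, §2] -/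
theorem not_perEasyCF_constDepth (K : ℕ) : ¬ SuccinctLift.PerEasyCF fun _ => K := by
  have h := not_perEasyCF_robust (p := 0) (q := 1) (Nat.zero_le _) K
  simpa using h

/-! ### §3 Non-degeneracy: for `1 ≤ K` no single `n` decides the robust statements -/

/-- Every `per_n` has a circuit over `ℂ` of product-depth `≤ 1` (the `ΣΠ` circuit along its support).
[cite: LST2021, §1] -/
theorem exists_computes_perPoly_productDepth_le_one (n : ℕ) :
    ∃ C : ArithCircuit ℂ (Fin n × Fin n), C.Computes (perPoly (Fin n) ℂ) ∧ C.productDepth ≤ 1 := by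
  obtain ⟨C, -, hC, hd⟩ :=
    ArithCircuit.exists_computes_productDepth_one_holds (k := ℂ) (σ := Fin n × Fin n) (perPoly (Fin n) ℂ)
  exact ⟨C, hC, hd⟩

/-- **Non-degeneracy of the robust budget**: for `1 ≤ K`, at EVERY `n` some circuit over `ℂ` computes `per_n`
within product-depth `⌊p · L₃ n / q⌋ + K` — so, unlike the vanishing budget (where `per_2` has no circuit at all,
`SuccinctLiftWallsDialAtTwo`), the hardness statements of §1 cannot be witnessed by the absence of circuits at one
`n`: they are size lower bounds. [cite: LST2021, §1] -/
theorem exists_computes_perPoly_robustBudget (p q : ℕ) {K : ℕ} (hK : 1 ≤ K) (n : ℕ) :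
    ∃ C : ArithCircuit ℂ (Fin n × Fin n), C.Computes (perPoly (Fin n) ℂ) ∧
      C.productDepth ≤ p * Nat.log 2 (Nat.log 2 (Nat.log 2 n)) / q + K := by
  obtain ⟨C, hC, hd⟩ := exists_computes_perPoly_productDepth_le_one n
  exact ⟨C, hC, hd.trans (hK.trans (Nat.le_add_left K _))⟩

/-- In particular at `n = 2`, where the vanishing budget is `0` and refutes every dial point outright, the robust
budget is `K ≥ 1` and `per_2` IS computed within it. [cite: LST2021, §1] -/
theorem exists_computes_perTwo_robustBudget (p q : ℕ) {K : ℕ} (hK : 1 ≤ K) :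
    ∃ C : ArithCircuit ℂ (Fin 2 × Fin 2), C.Computes (perPoly (Fin 2) ℂ) ∧
      C.productDepth ≤ p * Nat.log 2 (Nat.log 2 (Nat.log 2 2)) / q + K :=
  exists_computes_perPoly_robustBudget p q hK 2

/-- **Summary (the record sentence in kernel form).** For every slope `p / q ≤ 18/25` and every shift `K ≥ 1`:
the walls `K_alg`, `H`, `D` hold at the robust budget `⌊p · L₃ n / q⌋ + K` AND that budget admits a circuit for
every `per_n` (non-degenerate).  DECIDED-BY-RUNG; not evidence about the wall mechanisms; the route items at budget
`L₃ n + 1` are not affected. [cite: Burgisser2000, §4.1] [cite: LimayeSrinivasanTavenas2025, Cor. 4] -/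
theorem walls_robust_nondegenerate {p q : ℕ} (hpq : 25 * p ≤ 18 * q) {K : ℕ} (hK : 1 ≤ K) :
    (SuccinctLift.AlgConstantLiftAt (fun n => p * Nat.log 2 (Nat.log 2 (Nat.log 2 n)) / q + K) ∧
      SuccinctLift.HeightLiftAt (fun n => p * Nat.log 2 (Nat.log 2 (Nat.log 2 n)) / q + K) ∧
      SuccinctLift.AlgDescentAt (fun n => p * Nat.log 2 (Nat.log 2 (Nat.log 2 n)) / q + K)) ∧
    ∀ n : ℕ, ∃ C : ArithCircuit ℂ (Fin n × Fin n), C.Computes (perPoly (Fin n) ℂ) ∧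
      C.productDepth ≤ p * Nat.log 2 (Nat.log 2 (Nat.log 2 n)) / q + K :=
  ⟨walls_robust hpq K, exists_computes_perPoly_robustBudget p q hK⟩

end Summit.ValiantsHypothesis.ValiantsHypothesis.Theorems.SuccinctLiftWallsRobust
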